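import Summits.AtomisticToContinuum.BoseEinsteinCondensation.Theorems.BECDipoleTransportTransportToWindowSmearing
import HarnessLib

/-!
# Route `BECDipoleTransport`, support `TransportToWindow` (stmt-AtomisticToContinuum-14624) —
# the smeared-variance window bound

Helper file (`--supports` stmt-AtomisticToContinuum-14624): the analytic core of the proof of
`Summit.AtomisticToContinuum.BoseEinsteinCondensation.Theses.BECDipoleTransport.TransportToWindow`,
namely the inequality half of the smeared variance identity (route item `SmearedVarianceIdentity`,
with the constant `L³` in place of the sharp `2L³`, which is all the window bound consumes):

* `windowBound_kernel` — for a periodic `C¹` trial state `Ψ` of `n+1` bosons on the torus of side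
  `L` and any continuous integrable real kernel `η` with symbol `η̂(k) = ∫ η(w) conj(e_k(w)) dw`,
  `L³ Σ_{k≠0} |η̂(k)|² n_Ψ(k) ≤ (n+1) ∫_x∫_x′∫_Y |Ψ̄(x′,Y) − Ψ̄(x,Y)|²`,
  `Ψ̄(x,Y) = ∫ η(x−z)Ψ(z,Y)dz`, `n_Ψ(k)` the `cellOccupation` of the plane wave `L^{-3/2}e_k`;
* `windowBound_gaussian` — the same for the unit-mass Gaussian `η_R`, whose symbol is
  `e^{-R²p_k²/4}` (`integral_gaussian_mul_conj_cellWave`), giving the weights `e^{-R²p_k²/2}`,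
  `p_k = 2πk/L`, exactly as typed in the route.

Ingredients (all in `BECDipoleTransportTransportToWindowSmearing`): occupations through slices
(`cellOccupation_succ`), the convolution rule `ĉ_k(Ψ̄(·,Y)) = η̂(k)ĉ_k(Ψ(·,Y))`, Parseval on the
cell for `x′ ↦ Ψ̄(x′,Y) − Ψ̄(x,Y)` dropping the zero mode, and one Tonelli swap.
No new definitions. References: LSSY2005 §1.2 (1.17)–(1.18); Penrose–Onsager 1956.
-/

noncomputable section

namespace Summit.AtomisticToContinuum.BoseEinsteinCondensation.Theorems.BECDipoleTransport

open MeasureTheory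
open scoped ENNReal ComplexConjugate
open Literature.MathematicalPhysics.QuantumManyBody.BoseGas

variable {L : ℝ} {n : ℕ}

/-! ### The window bound for a general kernel -/

/-- **The smeared-variance window bound, general kernel.** For a periodic `C¹` trial state `Ψ` of
`n+1` bosons on the torus of side `L` and a continuous integrable real kernel `η` with symbol
`η̂(k) = ∫ η(w) conj(e_k(w)) dw`,
`L³ Σ_{k≠0} |η̂(k)|² n_Ψ(k) ≤ (n+1) ∫_x∫_x′∫_Y |Ψ̄(x′,Y) − Ψ̄(x,Y)|²`, where
`Ψ̄(x,Y) = ∫ η(x−z)Ψ(z,Y)dz` is the smeared slice and `n_Ψ(k)` the occupation of the plane wave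
`L^{-3/2}e_k` (`cellOccupation`). Proof: `n_Ψ(k) = (n+1)L³∫_Y|ĉ_k(Ψ(·,Y))|²`
(`cellOccupation_succ`), `ĉ_k(Ψ̄(·,Y)) = η̂(k)ĉ_k(Ψ(·,Y))` (`cellFourierCoeff_smear`), Parseval
for `x′ ↦ Ψ̄(x′,Y) − Ψ̄(x,Y)` dropping the zero mode (`sq_tsum_le_lintegral_sub`), Tonelli.
(The identity with `2L³` holds; the inequality with `L³` is what the window bound consumes.)
[folklore] -/
theorem windowBound_kernel (hL : 0 < L) (Ψ : PeriodicTrialState (n + 1) L) {η : Space → ℝ}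
    (hηc : Continuous η) (hηi : Integrable η) :
    ENNReal.ofReal (L ^ 3) * (∑' k : Fin 3 → ℤ, if k ≠ 0 then
        (‖∫ w, (η w : ℂ) * conj (cellWave L k w)‖₊ : ℝ≥0∞) ^ 2 *
          cellOccupation (n + 1) L (fun x => ((Real.sqrt (L ^ 3))⁻¹ : ℂ) * cellWave L k x) Ψ.ψ
        else 0) ≤
      ((n : ℝ≥0∞) + 1) * ∫⁻ x in cell L, ∫⁻ x' in cell L, ∫⁻ Y in cellN n L,
        (‖(∫ z, (η (x' - z) : ℂ) * Ψ.ψ (Matrix.vecCons z Y)) -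
          (∫ z, (η (x - z) : ℂ) * Ψ.ψ (Matrix.vecCons z Y))‖₊ : ℝ≥0∞) ^ 2 := by
  have hL3 : ENNReal.ofReal L ^ 3 ≠ 0 := pow_ne_zero _ (by simpa using hL)
  have hL3' : ENNReal.ofReal L ^ 3 ≠ ⊤ := ENNReal.pow_ne_top ENNReal.ofReal_ne_top
  have hΨc : Continuous Ψ.ψ := Ψ.contDiff.continuous
  obtain ⟨M, hM⟩ := exists_bound_of_periodic hL hΨc Ψ.periodic
  -- the smeared slices
  set F : Space → Config n → ℂ := fun x Y => ∫ w, (η w : ℂ) * Ψ.ψ (Matrix.vecCons (x - w) Y)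
    with hF
  have hFc : Continuous (Function.uncurry F) := continuous_smear hΨc hM hηc hηi
  have h0 : ∀ (x : Space) (Y : Config n),
      (∫ z, (η (x - z) : ℂ) * Ψ.ψ (Matrix.vecCons z Y)) = F x Y := fun x Y =>
    integral_kernel_sub_mul η (fun z => Ψ.ψ (Matrix.vecCons z Y)) x
  simp_rw [h0]
  -- the symbol and the slice coefficients
  set g : (Fin 3 → ℤ) → ℂ := fun k => ∫ w, (η w : ℂ) * conj (cellWave L k w) with hg
  set cΨ : Config n → (Fin 3 → ℤ) → ℂ := fun Y k =>
    cellFourierCoeff L (fun x => Ψ.ψ (Matrix.vecCons x Y)) k with hcΨ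
  have hslice_c : ∀ Y : Config n, Continuous fun x => Ψ.ψ (Matrix.vecCons x Y) := fun Y =>
    hΨc.comp (continuous_id.matrixVecCons continuous_const)
  have hslice_per : ∀ (Y : Config n) (x : Space) (k : Fin 3),
      Ψ.ψ (Matrix.vecCons (x + EuclideanSpace.single k L) Y) = Ψ.ψ (Matrix.vecCons x Y) :=
    fun Y x k => Ψ.vecCons_add_axis_left x Y k
  have hcoef : ∀ (Y : Config n) (k : Fin 3 → ℤ),
      cellFourierCoeff L (fun x => F x Y) k = g k * cΨ Y k := fun Y k =>
    cellFourierCoeff_smear hL (hslice_c Y) (hslice_per Y) (fun x => hM _) hηc hηi k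
  have hFY : ∀ Y : Config n, Continuous fun x => F x Y := fun Y =>
    hFc.comp (continuous_id.prodMk continuous_const)
  -- the common middle quantity `C = ∫_Y L³ Σ_{k≠0} |g k|² |ĉ_k(Ψ(·,Y))|²`
  set S : Config n → ℝ≥0∞ := fun Y => ∑' k : Fin 3 → ℤ,
    if k ≠ 0 then (‖g k‖₊ : ℝ≥0∞) ^ 2 * (‖cΨ Y k‖₊ : ℝ≥0∞) ^ 2 else 0 with hS
  -- Step 1 (Parseval, per slice and reference point)
  have h1 : ∀ (x : Space) (Y : Config n),
      ENNReal.ofReal L ^ 3 * S Y ≤ ∫⁻ x' in cell L, (‖F x' Y - F x Y‖₊ : ℝ≥0∞) ^ 2 := by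
    intro x Y
    have h := sq_tsum_le_lintegral_sub hL (hFY Y) x
    have hSY : S Y = ∑' k : Fin 3 → ℤ,
        if k ≠ 0 then ((‖cellFourierCoeff L (fun x' => F x' Y) k‖₊ : ℝ≥0∞) ^ 2) else 0 := by
      simp only [hS]
      refine tsum_congr fun k => ?_
      split_ifs with hk
      · rw [hcoef Y k, nnnorm_mul, ENNReal.coe_mul, mul_pow]
      · rfl
    rw [hSY]
    exact h
  -- Step 2 (Tonelli in `(x', Y)` and the outer integral)
  have hmeas : ∀ x : Space, AEMeasurable (Function.uncurry fun (x' : Space) (Y : Config n) =>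
      (‖F x' Y - F x Y‖₊ : ℝ≥0∞) ^ 2)
      (((volume : Measure Space).restrict (cell L)).prod
        ((volume : Measure (Config n)).restrict (cellN n L))) := by
    intro x
    have hc : Continuous fun p : Space × Config n => F p.1 p.2 - F x p.2 :=
      hFc.sub (hFc.comp (continuous_const.prodMk continuous_snd))
    exact (hc.measurable.nnnorm.coe_nnreal_ennreal.pow_const 2).aemeasurable
  have h2 : ∀ x : Space, ∫⁻ Y in cellN n L, ENNReal.ofReal L ^ 3 * S Y ≤
      ∫⁻ x' in cell L, ∫⁻ Y in cellN n L, (‖F x' Y - F x Y‖₊ : ℝ≥0∞) ^ 2 := by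
    intro x
    rw [lintegral_lintegral_swap (hmeas x)]
    exact lintegral_mono fun Y => h1 x Y
  have h3 : ENNReal.ofReal L ^ 3 * ∫⁻ Y in cellN n L, ENNReal.ofReal L ^ 3 * S Y ≤
      ∫⁻ x in cell L, ∫⁻ x' in cell L, ∫⁻ Y in cellN n L,
        (‖F x' Y - F x Y‖₊ : ℝ≥0∞) ^ 2 := by
    calc ENNReal.ofReal L ^ 3 * ∫⁻ Y in cellN n L, ENNReal.ofReal L ^ 3 * S Y
        = ∫⁻ _x in cell L, ∫⁻ Y in cellN n L, ENNReal.ofReal L ^ 3 * S Y := by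
          rw [setLIntegral_const, volume_cell, mul_comm]
      _ ≤ _ := lintegral_mono fun x => h2 x
  -- Step 3 (the left-hand side through slices)
  have hcm : ∀ k : Fin 3 → ℤ, Measurable fun Y : Config n => (‖cΨ Y k‖₊ : ℝ≥0∞) ^ 2 := by
    intro k
    have h : Measurable fun Y : Config n => cΨ Y k := by
      rw [hcΨ]
      exact measurable_cellFourierCoeff_slice hL hΨc k
    exact h.nnnorm.coe_nnreal_ennreal.pow_const 2
  have hSm : ∀ k : Fin 3 → ℤ, Measurable fun Y : Config n =>
      if k ≠ 0 then (‖g k‖₊ : ℝ≥0∞) ^ 2 * (‖cΨ Y k‖₊ : ℝ≥0∞) ^ 2 else 0 := by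
    intro k
    by_cases hk : k ≠ 0
    · simp_rw [if_pos hk]
      exact (hcm k).const_mul _
    · simp_rw [if_neg hk]
      exact measurable_const
  have hocc : ∀ k : Fin 3 → ℤ,
      cellOccupation (n + 1) L (fun x => ((Real.sqrt (L ^ 3))⁻¹ : ℂ) * cellWave L k x) Ψ.ψ =
        ((n : ℝ≥0∞) + 1) * ∫⁻ Y in cellN n L, ENNReal.ofReal L ^ 3 * (‖cΨ Y k‖₊ : ℝ≥0∞) ^ 2 := by
    intro k
    have hpw : (fun x => ((Real.sqrt (L ^ 3))⁻¹ : ℂ) * cellWave L k x) = planeWaveMode L k :=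
      funext fun x => (planeWaveMode_eq L k x).symm
    rw [hpw, cellOccupation_succ]
    simp only [nnnorm_sq_integral_conj_planeWaveMode_mul hL, hcΨ]
  have hlhs : ENNReal.ofReal (L ^ 3) * (∑' k : Fin 3 → ℤ, if k ≠ 0 then
      (‖g k‖₊ : ℝ≥0∞) ^ 2 *
        cellOccupation (n + 1) L (fun x => ((Real.sqrt (L ^ 3))⁻¹ : ℂ) * cellWave L k x) Ψ.ψ
      else 0) =
      ((n : ℝ≥0∞) + 1) * (ENNReal.ofReal L ^ 3 * ∫⁻ Y in cellN n L, ENNReal.ofReal L ^ 3 * S Y) := by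
    simp only [hocc]
    rw [ENNReal.ofReal_pow hL.le]
    have hT : ∀ Y : Config n, ENNReal.ofReal L ^ 3 * S Y = ∑' k : Fin 3 → ℤ,
        ENNReal.ofReal L ^ 3 *
          (if k ≠ 0 then (‖g k‖₊ : ℝ≥0∞) ^ 2 * (‖cΨ Y k‖₊ : ℝ≥0∞) ^ 2 else 0) := by
      intro Y
      simp only [hS]
      rw [ENNReal.tsum_mul_left]
    simp_rw [hT]
    rw [lintegral_tsum fun k => ((hSm k).const_mul _).aemeasurable,
      mul_left_comm ((n : ℝ≥0∞) + 1)]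
    congr 1
    rw [← ENNReal.tsum_mul_left]
    refine tsum_congr fun k => ?_
    by_cases hk : k ≠ 0
    · simp_rw [if_pos hk]
      have hY : ∀ Y : Config n,
          ENNReal.ofReal L ^ 3 * ((‖g k‖₊ : ℝ≥0∞) ^ 2 * (‖cΨ Y k‖₊ : ℝ≥0∞) ^ 2) =
            (‖g k‖₊ : ℝ≥0∞) ^ 2 * (ENNReal.ofReal L ^ 3 * (‖cΨ Y k‖₊ : ℝ≥0∞) ^ 2) :=
        fun Y => by ring
      simp_rw [hY]
      rw [lintegral_const_mul _ ((hcm k).const_mul _)]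
      ring
    · simp_rw [if_neg hk]
      simp
  rw [hlhs]
  exact mul_le_mul' le_rfl h3


/-! ### The Gaussian window bound -/

/-- The squared modulus of the Gaussian symbol is the Gaussian window weight:
`|e^{-R²p²/4}|² = e^{-R²p²/2}` (as an `ℝ≥0∞` identity for the symbol integral). [folklore] -/
theorem nnnorm_sq_gaussianSymbol {L R : ℝ} (hL : L ≠ 0) (hR : 0 < R) (k : Fin 3 → ℤ) :
    ((‖∫ w : Space, (((Real.pi * R ^ 2)⁻¹ * (Real.sqrt (Real.pi * R ^ 2))⁻¹ *
        Real.exp (-(‖w‖ ^ 2 / R ^ 2)) : ℝ) : ℂ) * conj (cellWave L k w)‖₊ : ℝ≥0∞) ^ 2) =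
      ENNReal.ofReal (Real.exp (-(R ^ 2 * (2 * Real.pi / L) ^ 2 * (∑ l, (k l : ℝ) ^ 2) / 2))) := by
  rw [integral_gaussian_mul_conj_cellWave hL hR k, coe_nnnorm_sq_eq_ofReal, Complex.norm_real,
    Real.norm_of_nonneg (Real.exp_pos _).le, sq, ← Real.exp_add]
  congr 2
  ring

/-- **The Gaussian window bound** (inequality half of `SmearedVarianceIdentity`, constant `L³`):
for `L, R > 0` and a periodic `C¹` trial state `Ψ` of `n+1` bosons on the torus of side `L`,
`L³ Σ_{k≠0} e^{-R²p_k²/2} n_Ψ(k) ≤ (n+1) ∫_x∫_x′∫_Y |Ψ̄_R(x′,Y) − Ψ̄_R(x,Y)|²`, with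
`Ψ̄_R(x,Y) = ∫ η_R(x−z)Ψ(z,Y)dz`, `η_R(w) = (πR²)^{-3/2}e^{-|w|²/R²}`, `p_k = 2πk/L`, typed verbatim
as in the route (`windowBound_kernel` for the Gaussian kernel, whose symbol is `e^{-R²p_k²/4}`).
[folklore] -/
theorem windowBound_gaussian (hL : 0 < L) {R : ℝ} (hR : 0 < R) (Ψ : PeriodicTrialState (n + 1) L) :
    ENNReal.ofReal (L ^ 3) * (∑' k : Fin 3 → ℤ, if k ≠ 0 then
        ENNReal.ofReal (Real.exp (-(R ^ 2 * (2 * Real.pi / L) ^ 2 * (∑ l, (k l : ℝ) ^ 2) / 2))) *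
          cellOccupation (n + 1) L (fun x => ((Real.sqrt (L ^ 3))⁻¹ : ℂ) * cellWave L k x) Ψ.ψ
        else 0) ≤
      ((n : ℝ≥0∞) + 1) * ∫⁻ x in cell L, ∫⁻ x' in cell L, ∫⁻ Y in cellN n L,
        (‖(∫ z : Space, (((Real.pi * R ^ 2)⁻¹ * (Real.sqrt (Real.pi * R ^ 2))⁻¹ *
            Real.exp (-(‖x' - z‖ ^ 2 / R ^ 2)) : ℝ) : ℂ) * Ψ.ψ (Matrix.vecCons z Y)) -
          (∫ z : Space, (((Real.pi * R ^ 2)⁻¹ * (Real.sqrt (Real.pi * R ^ 2))⁻¹ *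
            Real.exp (-(‖x - z‖ ^ 2 / R ^ 2)) : ℝ) : ℂ) * Ψ.ψ (Matrix.vecCons z Y))‖₊ :
          ℝ≥0∞) ^ 2 := by
  have h := windowBound_kernel hL Ψ
    (continuous_gaussianKernel ((Real.pi * R ^ 2)⁻¹ * (Real.sqrt (Real.pi * R ^ 2))⁻¹) R)
    (integrable_gaussianKernel ((Real.pi * R ^ 2)⁻¹ * (Real.sqrt (Real.pi * R ^ 2))⁻¹) hR.ne')
  simp only [nnnorm_sq_gaussianSymbol hL.ne' hR] at h
  exact h

end Summit.AtomisticToContinuum.BoseEinsteinCondensation.Theorems.BECDipoleTransport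

end
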